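import Summits.Parity.GeneralizedHardyLittlewood.Theorems.PrimeLevelFamEdgeMomentsBeyondDiagonalDiagGenericRemInner
import Summits.Parity.GeneralizedHardyLittlewood.Theorems.PrimeLevelFamEdgeMomentsBeyondDiagonalDiagGenericAssembly
import Summits.Parity.GeneralizedHardyLittlewood.Theorems.PrimeLevelFamEdgeMomentsBeyondDiagonalDiagRemFourFourEstimate
import HarnessLib

/-!
# Route `PrimeLevelFamEdge`, crux K_A `MomentsBeyondDiagonal` (stmt-Parity-20007), line «petersson_layers» v4, stub `stub_diag`:
# **THE GENERIC REMAINDER ESTIMATE (R_ij), PROVED for every order `(i,j)` with `i + j ≥ 2`** (brick (R7) — the outer `(c,g)` sum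
# and the closing arithmetic — of the census `Cruxes/MomentsBeyondDiagonal/Lines/petersson_layers_stub_diag_g19_generic_assembly.md`)

The hypothesis (R_ij) of `…DiagGenericAssembly.subDiag_of_genericRemainder` (window `(1, 3/2]`), VERBATIM, with the level-free
constants `E_ab = c_ab(1) + ∫_{(0,1]}(η·(…) − ∫…)/η`, `μ_m = ∫_{(0,1]} logᵐv·v/(1+v²)²` of the generic kernel lemma (no choice).
Assembly exactly as for the orders `(2,2)`, `(3,3)`, `(2,4)`, `(4,4)` (`…DiagRemFourFourEstimate.remainder_estimate₄₄`), from the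
generic inner estimate `…DiagGenericRemInner.abs_inner_rem_selberg_gen i j A` (envelope `Λ^e`, `e = 3(i+j)+4`, saving `(1+log K₁)^{−A}`,
`A = 2(i+j)+8`, so that `A + (i+j) = e + 4`), the `τ`-free Selberg rewriting of the `(c,g)` summand (`selbergRem_inner_eq_Wn`: the
decorations are the divisor moments themselves), `…DiagRemOuterPow.per_term_bound_gen_pow A` and the `Σ_cΣ_g` bookkeeping
(`…DiagRemTwoTwoOuter.sum_sum_divWeightSq_div_mul_le/_sq_le`), closed by `final_arith_gen` (budget `log^{i+j−3}`, written
`L^{i+j}/L³`, valid for every `i + j ≥ 2` — the power-saving term is `≪ 1/L ≤ L^{i+j}/L³`).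

* `xP_div_eq_Wn`, `selbergRem_inner_eq_Wn` — `x_{nk}/(nk) = W(n)·W_n(k)·P(log((M/n)/k)/log M)`, summed: the `(c,g)` summand of a
  Selberg form with ANY weight `w(k₁,k₂)` is `W(n)²·Σ_{k₁,k₂≤M/n} W_n(k₁)P(ℓ⁺₁/log M)W_n(k₂)P(ℓ⁺₂/log M)·w` (no `τ` factors);
* `final_arith_gen` — the closing arithmetic with budget `L^s/L³` (`s ≥ 2`, `A + s = e + 4`);
* `remainder_estimate_gen i j` (`2 ≤ i + j`) — **(R_ij): `∃ E μ, ∀ P admissible, ∀ Δ′ ∈ (1, 3/2], ∃ C q₀, ∀ q ≥ q₀: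
  |Sel_q(rem_ij)| ≤ C·log^{i+j}q̂/log³q̂`** — literally the hypothesis of `subDiag_of_genericRemainder` at `Δ = 3/2`.

With `subDiag_of_genericRemainder` this gives `SubDiag` (= the registered stub `stub_diag`, filed next, by name). Def-free; theorems only.
Helper `--supports stmt-Parity-20007`; K_A, K_B and the Parity summit are NOT proved (the stubs `stub_rung/core/band/farP` remain);
nothing about Landau–Siegel zeros.

## References
* E. Kowalski, P. Michel, J. VanderKam, J. reine angew. Math. 526 (2000), (22)–(28) pp. 12–15 and Prop. 5.1 p. 18.
  [cite: KowalskiMichelVanderKam2000, (23)–(28) and Prop. 5.1 — derivation (remainder of the diagonal main term, every order, general Q)]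
-/

noncomputable section

open scoped Real ArithmeticFunction.Moebius
open Finset ArithmeticFunction Polynomial Real MeasureTheory
open Set (Ioi)

namespace Summit.Parity.GeneralizedHardyLittlewood.Theorems.MomentsBeyondDiagonal.DiagCorner

open Literature.NumberTheory.LFunctions Literature.NumberTheory.LFunctions.KMV2000
open MollifierMainTerm (W)
open Summit.Parity.GeneralizedHardyLittlewood.Theorems.BeyondDiagonalBeatsQuarter.KernelFormXSq
  (copTauW copTauW_apply divWeight divWeight_nonneg one_le_divWeight abs_W_le W_apply'' isMultiplicative_W'
    W_eq_zero_of_not_squarefree)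
open Summit.Parity.GeneralizedHardyLittlewood.Theorems.BeyondDiagonalBeatsQuarter.Corner
open Summit.Parity.GeneralizedHardyLittlewood.Theorems.MomentsBeyondDiagonal.DiagKernel (coeff_zero_one_of_admissible)

/-! ### The `τ`-free Selberg rewriting -/

/-- `x_{nk}/(nk) = W(n)·W_n(k)·P(log((M/n)/k)/log M)` for `x_m = μ(m)ψ(m)⁻¹P(log(M/m)/log M)`, `n, k ≥ 1`, `W_n(k) = [(k,n)=1]W(k)`
(`W(nk) = W(n)W(k)` for `(n,k) = 1`, `= 0` otherwise). [cite: KowalskiMichelVanderKam2000, (23) — derivation] -/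
theorem xP_div_eq_Wn (P : ℝ[X]) (M : ℝ) {n k : ℕ} (hn : n ≠ 0) (hk : k ≠ 0) :
    ((μ (n * k) : ℝ) * ((psi (n * k))⁻¹ *
        P.eval (Real.log (M / ((n * k : ℕ) : ℝ)) / Real.log M))) / ((n * k : ℕ) : ℝ) =
      W n * ((if k.Coprime n then W k else 0) * P.eval (Real.log (M / n / k) / Real.log M)) := by
  have hW : ((μ (n * k) : ℝ) * ((psi (n * k))⁻¹ *
      P.eval (Real.log (M / ((n * k : ℕ) : ℝ)) / Real.log M))) / ((n * k : ℕ) : ℝ) =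
      W (n * k) * P.eval (Real.log (M / ((n * k : ℕ) : ℝ)) / Real.log M) := by
    rw [W_apply'' (mul_ne_zero hn hk)]
    have : ((n * k : ℕ) : ℝ) ≠ 0 := by exact_mod_cast mul_ne_zero hn hk
    field_simp
  rw [hW]
  have hlog : Real.log (M / ((n * k : ℕ) : ℝ)) = Real.log (M / n / k) := by
    push_cast; rw [div_div]
  rw [hlog]
  by_cases hc : k.Coprime n
  · rw [if_pos hc, isMultiplicative_W'.map_mul_of_coprime hc.symm]
    ring
  · rw [if_neg hc]
    have hns : ¬ Squarefree (n * k) := fun h ↦ hc (Nat.coprime_of_squarefree_mul h).symm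
    rw [W_eq_zero_of_not_squarefree hns]
    ring

/-- **The `(c,g)` summand of a Selberg form with an arbitrary weight, `τ`-free**: for `n ≥ 1`, `M > 0` and any `w`,
`Σ_{k₁,k₂ ≤ ⌊M⌋/n} (x_{nk₁}/(nk₁))(x_{nk₂}/(nk₂))·w(k₁,k₂) = W(n)²·Σ_{k₁,k₂ ≤ M/n} W_n(k₁)P(ℓ⁺(k₁)/log M)·(W_n(k₂)P(ℓ⁺(k₂)/log M))·w(k₁,k₂)`.
[cite: KowalskiMichelVanderKam2000, (23) — derivation] -/
theorem selbergRem_inner_eq_Wn (P : ℝ[X]) {M : ℝ} (hM : 0 < M) {n : ℕ} (hn : n ≠ 0) (w : ℕ → ℕ → ℝ) :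
    ∑ k₁ ∈ Icc 1 (⌊M⌋₊ / n), ∑ k₂ ∈ Icc 1 (⌊M⌋₊ / n),
      ((μ (n * k₁) : ℝ) * ((psi (n * k₁))⁻¹ *
          P.eval (Real.log (M / ((n * k₁ : ℕ) : ℝ)) / Real.log M))) / ((n * k₁ : ℕ) : ℝ) *
        (((μ (n * k₂) : ℝ) * ((psi (n * k₂))⁻¹ *
          P.eval (Real.log (M / ((n * k₂ : ℕ) : ℝ)) / Real.log M))) / ((n * k₂ : ℕ) : ℝ)) *
        w k₁ k₂ =
    W n ^ 2 * ∑ k₁ ∈ Icc 1 ⌊M / (n : ℝ)⌋₊, ∑ k₂ ∈ Icc 1 ⌊M / (n : ℝ)⌋₊,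
      (if k₁.Coprime n then W k₁ else 0) * P.eval (ellp (M / (n : ℝ)) k₁ / Real.log M) *
        ((if k₂.Coprime n then W k₂ else 0) * P.eval (ellp (M / (n : ℝ)) k₂ / Real.log M)) * w k₁ k₂ := by
  have hY0 : 0 ≤ M / (n : ℝ) := by positivity
  rw [Nat.floor_div_natCast, Finset.mul_sum]
  refine Finset.sum_congr rfl fun k₁ hk₁ ↦ ?_
  rw [Finset.mul_sum]
  refine Finset.sum_congr rfl fun k₂ hk₂ ↦ ?_
  have hk₁0 : k₁ ≠ 0 := by have := (Finset.mem_Icc.1 hk₁).1; omega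
  have hk₂0 : k₂ ≠ 0 := by have := (Finset.mem_Icc.1 hk₂).1; omega
  have hk₁' : k₁ ∈ Icc 1 ⌊M / (n : ℝ)⌋₊ := by rwa [Nat.floor_div_natCast]
  have hk₂' : k₂ ∈ Icc 1 ⌊M / (n : ℝ)⌋₊ := by rwa [Nat.floor_div_natCast]
  rw [ellp_eq_log hY0 hk₁', ellp_eq_log hY0 hk₂', xP_div_eq_Wn P M hn hk₁0, xP_div_eq_Wn P M hn hk₂0]
  ring

/-! ### The closing arithmetic with budget `L^{s}/L³` -/

/-- The closing arithmetic of (R_ij): `CΛ^e((Z(2+l))²A₁ + 3Z²(2+l)A₂) ≤ C·Z²(16·5^{e+2}C₈ + 6·4^A·5^{e+1})·L^s/L³` from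
`A₁ ≤ 4C₈/(1+L)^{e+3}`, `A₂ ≤ 4^A/L^A`, `A + s = e + 4`, `s ≥ 2`, `2 + l ≤ 2Λ`, `1 ≤ Λ ≤ 5L`, `L ≥ 1`
(`…DiagRemOuterPow.final_arith_pow` has budget `L^b`, `b ≥ 0`; here also the orders with `i + j = 2`). [folklore] -/
theorem final_arith_gen {e A s : ℕ} (hs : 2 ≤ s) (hAs : A + s = e + 4) {C C₈ Z L Lam l A₁ A₂ : ℝ} (hC : 0 ≤ C) (hC₈ : 0 ≤ C₈)
    (hL : 1 ≤ L) (hLam1 : 1 ≤ Lam) (hLam : Lam ≤ 5 * L) (hl : 0 ≤ l) (hlLam : 2 + l ≤ 2 * Lam) (hA₁0 : 0 ≤ A₁)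
    (hA₁ : A₁ ≤ 4 * C₈ / (1 + L) ^ (e + 3)) (hA₂0 : 0 ≤ A₂) (hA₂ : A₂ ≤ 4 ^ A / L ^ A) :
    C * Lam ^ e * ((Z * (2 + l)) ^ 2 * A₁ + 3 * Z ^ 2 * (2 + l) * A₂) ≤
      C * (Z ^ 2 * (16 * 5 ^ (e + 2) * C₈ + 6 * 4 ^ A * 5 ^ (e + 1))) * L ^ s / L ^ 3 := by
  have hL0 : 0 < L := by linarith
  have hLam0 : 0 ≤ Lam := by linarith
  have h2l : (2 + l) ^ 2 ≤ (2 * Lam) ^ 2 := pow_le_pow_left₀ (by linarith) hlLam 2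
  have hΛe2 : Lam ^ (e + 2) ≤ (5 * L) ^ (e + 2) := pow_le_pow_left₀ hLam0 hLam (e + 2)
  have hΛe1 : Lam ^ (e + 1) ≤ (5 * L) ^ (e + 1) := pow_le_pow_left₀ hLam0 hLam (e + 1)
  have h1L : L ^ (e + 3) ≤ (1 + L) ^ (e + 3) := pow_le_pow_left₀ hL0.le (by linarith) (e + 3)
  have hZ2 : 0 ≤ Z ^ 2 := sq_nonneg Z
  have hinvL : 1 / L ≤ L ^ s / L ^ 3 := by
    rw [div_le_div_iff₀ hL0 (by positivity), one_mul]
    calc L ^ 3 = L ^ 2 * L := by ring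
      _ ≤ L ^ s * L := mul_le_mul_of_nonneg_right (pow_le_pow_right₀ hL hs) hL0.le
  have hLsA : L ^ (e + 1) / L ^ A = L ^ s / L ^ 3 := by
    rw [div_eq_div_iff (by positivity) (by positivity), ← pow_add, ← pow_add]
    congr 1; omega
  -- first piece
  have p1 : Lam ^ e * ((Z * (2 + l)) ^ 2 * A₁) ≤ Z ^ 2 * (16 * 5 ^ (e + 2) * C₈) * (L ^ s / L ^ 3) := by
    calc Lam ^ e * ((Z * (2 + l)) ^ 2 * A₁) = Lam ^ e * (Z ^ 2 * (2 + l) ^ 2 * A₁) := by ring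
      _ ≤ Lam ^ e * (Z ^ 2 * (2 * Lam) ^ 2 * (4 * C₈ / (1 + L) ^ (e + 3))) := by gcongr
      _ = Z ^ 2 * (16 * C₈) * Lam ^ (e + 2) / (1 + L) ^ (e + 3) := by ring
      _ ≤ Z ^ 2 * (16 * C₈) * (5 * L) ^ (e + 2) / L ^ (e + 3) := by gcongr
      _ = Z ^ 2 * (16 * 5 ^ (e + 2) * C₈) * (1 / L) := by
          rw [mul_pow, pow_succ L (e + 2)]
          field_simp
      _ ≤ Z ^ 2 * (16 * 5 ^ (e + 2) * C₈) * (L ^ s / L ^ 3) := by gcongr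
  -- second piece
  have p2 : Lam ^ e * (3 * Z ^ 2 * (2 + l) * A₂) ≤ Z ^ 2 * (6 * 4 ^ A * 5 ^ (e + 1)) * (L ^ s / L ^ 3) := by
    calc Lam ^ e * (3 * Z ^ 2 * (2 + l) * A₂) ≤ Lam ^ e * (3 * Z ^ 2 * (2 * Lam) * (4 ^ A / L ^ A)) := by gcongr
      _ = Z ^ 2 * (6 * 4 ^ A) * Lam ^ (e + 1) / L ^ A := by ring
      _ ≤ Z ^ 2 * (6 * 4 ^ A) * (5 * L) ^ (e + 1) / L ^ A := by gcongr
      _ = Z ^ 2 * (6 * 4 ^ A * 5 ^ (e + 1)) * (L ^ (e + 1) / L ^ A) := by rw [mul_pow]; ring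
      _ = Z ^ 2 * (6 * 4 ^ A * 5 ^ (e + 1)) * (L ^ s / L ^ 3) := by rw [hLsA]
  calc C * Lam ^ e * ((Z * (2 + l)) ^ 2 * A₁ + 3 * Z ^ 2 * (2 + l) * A₂)
      = C * (Lam ^ e * ((Z * (2 + l)) ^ 2 * A₁) + Lam ^ e * (3 * Z ^ 2 * (2 + l) * A₂)) := by ring
    _ ≤ C * (Z ^ 2 * (16 * 5 ^ (e + 2) * C₈) * (L ^ s / L ^ 3) + Z ^ 2 * (6 * 4 ^ A * 5 ^ (e + 1)) * (L ^ s / L ^ 3)) := by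
        gcongr
    _ = C * (Z ^ 2 * (16 * 5 ^ (e + 2) * C₈ + 6 * 4 ^ A * 5 ^ (e + 1))) * L ^ s / L ^ 3 := by ring

/-! ### (R_ij) -/

set_option maxHeartbeats 12000000 in
set_option maxRecDepth 20000 in
-- large statement (verbatim hypothesis of `subDiag_of_genericRemainder`, `Δ = 3/2`) and assembly
/-- **THE GENERIC REMAINDER ESTIMATE (R_ij) of order `(i,j)`, `i + j ≥ 2`** (window `(1, 3/2]`): the hypothesis of
`…DiagGenericAssembly.subDiag_of_genericRemainder` at `Δ = 3/2`, with the explicit level-free constants `E_ab`, `μ_m`.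
[cite: KowalskiMichelVanderKam2000, (23)–(28) and Prop. 5.1 — derivation (remainder of the diagonal main term, every order, general Q)] -/
theorem remainder_estimate_gen (i j : ℕ) (hij : 2 ≤ i + j) :
    ∃ (E : ℕ → ℕ → ℝ) (mu : ℕ → ℝ), ∀ P : ℝ[X], KMV2000.Admissible P → ∀ Δ' : ℝ, 1 < Δ' → Δ' ≤ 3 / 2 →
      ∃ C : ℝ, ∃ q₀ : ℕ, ∀ (q : ℕ) [NeZero q], q₀ ≤ q →
        |∑ c ∈ Icc 1 ⌊qhat q ^ Δ'⌋₊, ∑ g ∈ Icc 1 (⌊qhat q ^ Δ'⌋₊ / c), (μ g : ℝ) * c *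
          ∑ k₁ ∈ Icc 1 (⌊qhat q ^ Δ'⌋₊ / (c * g)), ∑ k₂ ∈ Icc 1 (⌊qhat q ^ Δ'⌋₊ / (c * g)),
            ((μ (c * g * k₁) : ℝ) * ((psi (c * g * k₁))⁻¹ *
                P.eval (Real.log (qhat q ^ Δ' / ((c * g * k₁ : ℕ) : ℝ)) / Real.log (qhat q ^ Δ')))) / ((c * g * k₁ : ℕ) : ℝ) *
              (((μ (c * g * k₂) : ℝ) * ((psi (c * g * k₂))⁻¹ *
                P.eval (Real.log (qhat q ^ Δ' / ((c * g * k₂ : ℕ) : ℝ)) / Real.log (qhat q ^ Δ')))) / ((c * g * k₂ : ℕ) : ℝ)) *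
              (∑ a ∈ range (i + 1), ∑ b ∈ range (j + 1),
                (i.choose a : ℝ) * (j.choose b) *
                ((1 / 2) ^ (i - a + (j - b)) * ∑ r ∈ range (i - a + 1), ∑ s ∈ range (j - b + 1),
                  ((i - a).choose r : ℝ) * ((j - b).choose s) * (-1) ^ s *
                      (2 * (Real.log (qhat q) - Real.log g) - Real.log k₁ - Real.log k₂) ^ (i - a - r + (j - b - s)) *
                    ∑ t ∈ range (r + s + 1), ((r + s).choose t : ℝ) *
                      ((∑ d ∈ k₁.divisors, (2 * Real.log d - Real.log k₁) ^ t) *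
                        ∑ e ∈ k₂.divisors, (2 * Real.log e - Real.log k₂) ^ (r + s - t))) *
                ((∫ u₁ in Ioi (0 : ℝ), Real.log u₁ ^ a *
                  ∫ u₂ in Ioi ((((g * g * (k₁ * k₂) : ℕ) : ℝ) / qhat q ^ 2) / u₁),
                    Real.exp (-(u₁ + u₂)) / (1 - Real.exp (-(u₁ + u₂))) ^ 2 * Real.log u₂ ^ b) -
                  (E a b + (∑ i' ∈ Finset.range (a + 1), ∑ j' ∈ Finset.range (b + 1),
                  ((a).choose i' : ℝ) * ((b).choose j' : ℝ) * ((-1) ^ j' + (-1) ^ i') * mu (i' + j') *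
                    ((-1 / 2 : ℝ) ^ (a - i' + (b - j')) * (2 * (Real.log (qhat q) - Real.log g) - Real.log k₁ - Real.log k₂) ^ (a - i' + (b - j') + 1) /
                      (((a - i' + (b - j') : ℕ) : ℝ) + 1))))))| ≤
          C * Real.log (qhat q) ^ (i + j) / Real.log (qhat q) ^ 3 := by
  refine ⟨fun a b ↦ ((∫ u₁ in Set.Ioi (0 : ℝ), Real.log u₁ ^ a * ∫ u₂ in Set.Ioi (1 / u₁), Real.exp (-(u₁ + u₂)) / (1 - Real.exp (-(u₁ + u₂))) ^ 2 * Real.log u₂ ^ b) + (∫ η in Set.Ioc (0 : ℝ) 1, (η * (∫ u in Set.Ioi (0 : ℝ), Real.log u ^ a * Real.log (η / u) ^ b * (Real.exp (-(u + η / u)) / (1 - Real.exp (-(u + η / u))) ^ 2) / u) - ∫ v in Set.Ioc (0 : ℝ) 1, ((-(Real.log (1 / η) / 2) + Real.log v) ^ a * (-(Real.log (1 / η) / 2) - Real.log v) ^ b + (-(Real.log (1 / η) / 2) - Real.log v) ^ a * (-(Real.log (1 / η) / 2) + Real.log v) ^ b) * (v / (1 + v ^ 2) ^ 2)) / η)),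
    fun m ↦ (∫ v in Set.Ioc (0 : ℝ) 1, Real.log v ^ (m) * (v / (1 + v ^ 2) ^ 2)), fun P hP Δ' h1 h32 ↦ ?_⟩
  beta_reduce
  obtain ⟨hP0, -⟩ := coeff_zero_one_of_admissible hP
  obtain ⟨Cin, hCin, hI⟩ := abs_inner_rem_selberg_gen i j (2 * (i + j) + 8) P hP0
  obtain ⟨C₈, hC₈, hC₈b⟩ := rpow_neg_le_div_log_pow (show (0 : ℝ) < 1 / 8 by norm_num) (3 * (i + j) + 4 + 3)
  set Z₂ : ℝ := (∑' d : ℕ, (d : ℝ) ^ (-(5 / 4 : ℝ))) ^ 2 with hZ₂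
  have hZ₂0 : 0 ≤ Z₂ := sq_nonneg _
  obtain ⟨q₃, hq₃⟩ := exists_log_qhat_ge (2 : ℝ)
  refine ⟨Cin * (Z₂ ^ 2 * (16 * 5 ^ (3 * (i + j) + 4 + 2) * C₈ + 6 * 4 ^ (2 * (i + j) + 8) * 5 ^ (3 * (i + j) + 4 + 1))), q₃,
    fun q _ hq ↦ ?_⟩
  -- the level
  have hl2 : (2 : ℝ) ≤ Real.log (qhat q) := hq₃ q hq
  set Q : ℝ := qhat q with hQdef
  have hQ0' : 0 ≤ Q := by rw [hQdef]; unfold qhat; positivity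
  have hQ : 0 < Q := lt_of_le_of_ne hQ0' fun h0 ↦ by rw [← h0, Real.log_zero] at hl2; linarith
  have hQ3 : 3 ≤ Q := by
    have := Real.add_one_le_exp (Real.log Q)
    rw [Real.exp_log hQ] at this
    linarith
  have hQ1 : 1 ≤ Q := by linarith
  have hQ2 : 2 ≤ Q := by linarith
  set LQ : ℝ := Real.log Q with hLQdef
  have hLQ1 : 1 ≤ LQ := by linarith
  -- the mollifier length
  set M : ℝ := Q ^ Δ' with hMdef
  have hMQ : Q ≤ M := by rw [hMdef]; exact Real.self_le_rpow_of_one_le hQ1 h1.le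
  have hM2 : 2 ≤ M := by linarith
  have hM1 : 1 ≤ M := by linarith
  have hM0 : 0 < M := by linarith
  have hM32 : M ≤ Q ^ (3 / 2 : ℝ) := Real.rpow_le_rpow_of_exponent_le hQ1 h32
  have hlogM : Real.log M = Δ' * LQ := by rw [hMdef, hLQdef]; exact Real.log_rpow hQ Δ'
  have hlogM0 : 0 ≤ Real.log M := Real.log_nonneg hM1
  set Lam : ℝ := 1 + 2 * Real.log M + Real.log Q with hLamdef
  have hLam1 : 1 ≤ Lam := by rw [hLamdef]; linarith
  have hLam5 : Lam ≤ 5 * LQ := by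
    rw [hLamdef, hlogM]
    have : Δ' * LQ ≤ 3 / 2 * LQ := mul_le_mul_of_nonneg_right h32 (by linarith)
    rw [← hLQdef]; linarith
  set N : ℕ := ⌊M⌋₊ with hNdef
  have hN1 : 1 ≤ N := Nat.le_floor (by simpa using hM1)
  have hNM : (N : ℝ) ≤ M := Nat.floor_le hM0.le
  have hN0 : (0 : ℝ) < N := by exact_mod_cast hN1
  have hlogN0 : 0 ≤ Real.log (N : ℝ) := Real.log_nonneg (by exact_mod_cast hN1)
  have hlogN : Real.log (N : ℝ) ≤ Real.log M := Real.log_le_log hN0 hNM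
  have h1lN : 1 + Real.log (N : ℝ) ≤ Lam := by
    rw [hLamdef]; have : 0 ≤ Real.log Q := by rw [← hLQdef]; linarith
    linarith
  have h2lN : 2 + Real.log (N : ℝ) ≤ 2 * Lam := by linarith
  have hLame : 0 ≤ Lam ^ (3 * (i + j) + 4) := by positivity
  -- the threshold `K₁ = ⌊Q^{1/4}⌋`
  obtain ⟨hK1, hKQ, hKlog⟩ := floor_rpow_facts hQ1 (show (0 : ℝ) < 1 / 4 by norm_num)
  set K₁ : ℕ := ⌊Q ^ (1 / 4 : ℝ)⌋₊ with hK₁def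
  have hK0 : (0 : ℝ) ≤ K₁ := Nat.cast_nonneg _
  have hlogK0 : 0 ≤ Real.log (K₁ : ℝ) := Real.log_natCast_nonneg K₁
  -- the power savings `A₁ ≤ 4C₈/(1+LQ)^{e+3}`
  have hKM : (K₁ : ℝ) * M ≤ Q ^ (1 / 4 : ℝ) * Q ^ (3 / 2 : ℝ) := mul_le_mul hKQ hM32 hM0.le (by positivity)
  have hQ8 : Q ^ (-(1 / 8 : ℝ)) ≤ C₈ / (1 + LQ) ^ (3 * (i + j) + 4 + 3) := hC₈b Q hQ1
  have hQ80 : 0 ≤ Q ^ (-(1 / 8 : ℝ)) := by positivity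
  have hb1 : Real.sqrt (2 * K₁ * M) / Q ≤ Real.sqrt 2 * Q ^ (-(1 / 8 : ℝ)) := by
    have hsq : (Q ^ (7 / 8 : ℝ)) ^ 2 = Q ^ (1 / 4 : ℝ) * Q ^ (3 / 2 : ℝ) := by
      rw [← Real.rpow_natCast, ← Real.rpow_mul hQ.le, ← Real.rpow_add hQ]
      congr 1; norm_num
    have h1' : 2 * (K₁ : ℝ) * M ≤ 2 * (Q ^ (7 / 8 : ℝ)) ^ 2 := by rw [hsq]; linarith
    have h2' : Real.sqrt (2 * K₁ * M) ≤ Real.sqrt 2 * Q ^ (7 / 8 : ℝ) := by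
      calc Real.sqrt (2 * K₁ * M) ≤ Real.sqrt (2 * (Q ^ (7 / 8 : ℝ)) ^ 2) := Real.sqrt_le_sqrt h1'
        _ = Real.sqrt 2 * Q ^ (7 / 8 : ℝ) := by rw [Real.sqrt_mul (by norm_num), Real.sqrt_sq (by positivity)]
    rw [div_le_iff₀ hQ]
    refine h2'.trans (le_of_eq ?_)
    rw [mul_assoc, ← Real.rpow_add_one hQ.ne']
    congr 1; norm_num
  have hb2 : 2 * K₁ * M / Q ^ 2 ≤ 2 * Q ^ (-(1 / 8 : ℝ)) := by
    have h74 : Q ^ (1 / 4 : ℝ) * Q ^ (3 / 2 : ℝ) = Q ^ (-(1 / 4) : ℝ) * Q ^ 2 := by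
      rw [← Real.rpow_add hQ, show (1 / 4 : ℝ) + 3 / 2 = -(1 / 4) + 2 by norm_num, Real.rpow_add hQ, Real.rpow_two]
    have hKM' : (K₁ : ℝ) * M ≤ Q ^ (-(1 / 4) : ℝ) * Q ^ 2 := h74 ▸ hKM
    have h48 : Q ^ (-(1 / 4) : ℝ) ≤ Q ^ (-(1 / 8 : ℝ)) := Real.rpow_le_rpow_of_exponent_le hQ1 (by norm_num)
    rw [div_le_iff₀ (by positivity)]
    nlinarith [sq_nonneg Q]
  have hs2 : Real.sqrt 2 ≤ 2 := by
    have := Real.sq_sqrt (show (0 : ℝ) ≤ 2 by norm_num)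
    nlinarith [Real.sqrt_nonneg 2]
  have hA₁0 : 0 ≤ Real.sqrt (2 * K₁ * M) / Q + 2 * K₁ * M / Q ^ 2 := by positivity
  have hA₁ : Real.sqrt (2 * K₁ * M) / Q + 2 * K₁ * M / Q ^ 2 ≤ 4 * C₈ / (1 + LQ) ^ (3 * (i + j) + 4 + 3) := by
    calc _ ≤ Real.sqrt 2 * Q ^ (-(1 / 8 : ℝ)) + 2 * Q ^ (-(1 / 8 : ℝ)) := add_le_add hb1 hb2
      _ ≤ 2 * Q ^ (-(1 / 8 : ℝ)) + 2 * Q ^ (-(1 / 8 : ℝ)) := by gcongr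
      _ = 4 * Q ^ (-(1 / 8 : ℝ)) := by ring
      _ ≤ 4 * (C₈ / (1 + LQ) ^ (3 * (i + j) + 4 + 3)) := by gcongr
      _ = 4 * C₈ / (1 + LQ) ^ (3 * (i + j) + 4 + 3) := by ring
  -- the log saving `A₂ ≤ 4^A/LQ^A`
  have hA₂0 : 0 ≤ 1 / (1 + Real.log (K₁ : ℝ)) ^ (2 * (i + j) + 8) := by positivity
  have hA₂ : 1 / (1 + Real.log (K₁ : ℝ)) ^ (2 * (i + j) + 8) ≤ 4 ^ (2 * (i + j) + 8) / LQ ^ (2 * (i + j) + 8) := by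
    have hx : LQ ≤ 4 * (1 + Real.log (K₁ : ℝ)) := by rw [hLQdef]; linarith
    have hx12 : LQ ^ (2 * (i + j) + 8) ≤ (4 * (1 + Real.log (K₁ : ℝ))) ^ (2 * (i + j) + 8) :=
      pow_le_pow_left₀ (by linarith) hx _
    rw [div_le_div_iff₀ (by positivity) (by positivity), one_mul, mul_pow] at *
    linarith
  -- the per-term input
  have hF := fun (n g : ℕ) (hn : n ≠ 0) (hg : g ≠ 0) (hnM : (n : ℝ) ≤ M) (hgM : (g : ℝ) ≤ M) (K : ℕ)
      (hK : 2 * ((g : ℝ) ^ 2 / Q ^ 2) * K * (M / n) ≤ 1) ↦ hI n g hn hg Q M hQ2 hM2 hnM hgM K hK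
  -- rewrite the inner sums (`τ`-free, generic weight) and bound termwise
  rw [Finset.sum_congr rfl fun c hc ↦ Finset.sum_congr rfl fun g hg ↦ by
    rw [selbergRem_inner_eq_Wn P hM0 (n := c * g)
      (mul_ne_zero (by have := (Finset.mem_Icc.1 hc).1; omega) (by have := (Finset.mem_Icc.1 hg).1; omega))]]
  have hterm := fun c (hc : c ∈ Icc 1 N) g (hg : g ∈ Icc 1 (N / c)) ↦
    per_term_bound_gen_pow (2 * (i + j) + 8) (w := fun n ↦ divWeight n ^ 2) (E := Lam ^ (3 * (i + j) + 4)) hCin.le hLame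
      (fun n ↦ sq_nonneg _) hQ hM1 hF K₁ hc hg
  calc _ ≤ ∑ c ∈ Icc 1 N, ∑ g ∈ Icc 1 (N / c),
        Cin * Lam ^ (3 * (i + j) + 4) * (divWeight (c * g) ^ 2 / ((c : ℝ) * g) * (Real.sqrt (2 * K₁ * M) / Q + 2 * K₁ * M / Q ^ 2) +
          divWeight (c * g) ^ 2 / ((c : ℝ) * g ^ 2) * (1 / (1 + Real.log K₁) ^ (2 * (i + j) + 8))) := by
        refine (Finset.abs_sum_le_sum_abs _ _).trans (Finset.sum_le_sum fun c hc ↦ ?_)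
        exact (Finset.abs_sum_le_sum_abs _ _).trans (Finset.sum_le_sum fun g hg ↦ hterm c hc g hg)
    _ = Cin * Lam ^ (3 * (i + j) + 4) * ((∑ c ∈ Icc 1 N, ∑ g ∈ Icc 1 (N / c), divWeight (c * g) ^ 2 / ((c : ℝ) * g)) *
            (Real.sqrt (2 * K₁ * M) / Q + 2 * K₁ * M / Q ^ 2) +
          (∑ c ∈ Icc 1 N, ∑ g ∈ Icc 1 (N / c), divWeight (c * g) ^ 2 / ((c : ℝ) * g ^ 2)) *
            (1 / (1 + Real.log K₁) ^ (2 * (i + j) + 8))) := by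
        rw [Finset.sum_mul, Finset.sum_mul, ← Finset.sum_add_distrib, Finset.mul_sum]
        refine Finset.sum_congr rfl fun c _ ↦ ?_
        rw [Finset.sum_mul, Finset.sum_mul, ← Finset.sum_add_distrib, Finset.mul_sum]
    _ ≤ Cin * Lam ^ (3 * (i + j) + 4) * ((Z₂ * (2 + Real.log N)) ^ 2 * (Real.sqrt (2 * K₁ * M) / Q + 2 * K₁ * M / Q ^ 2) +
          3 * Z₂ ^ 2 * (2 + Real.log N) * (1 / (1 + Real.log K₁) ^ (2 * (i + j) + 8))) := by
        have hCL : 0 ≤ Cin * Lam ^ (3 * (i + j) + 4) := by positivity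
        apply mul_le_mul_of_nonneg_left _ hCL
        exact add_le_add (mul_le_mul_of_nonneg_right (sum_sum_divWeightSq_div_mul_le hN1) hA₁0)
          (mul_le_mul_of_nonneg_right (sum_sum_divWeightSq_div_mul_sq_le hN1) hA₂0)
    _ ≤ Cin * (Z₂ ^ 2 * (16 * 5 ^ (3 * (i + j) + 4 + 2) * C₈ + 6 * 4 ^ (2 * (i + j) + 8) * 5 ^ (3 * (i + j) + 4 + 1))) *
          LQ ^ (i + j) / LQ ^ 3 :=
        final_arith_gen (e := 3 * (i + j) + 4) (A := 2 * (i + j) + 8) (s := i + j) hij (by ring) hCin.le hC₈.le hLQ1 hLam1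
          hLam5 hlogN0 h2lN hA₁0 hA₁ hA₂0 hA₂

end Summit.Parity.GeneralizedHardyLittlewood.Theorems.MomentsBeyondDiagonal.DiagCorner

end
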